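/-
Copyright: the b2b-balaban cell (near-miss cell 7), T⁴-continuum CRUX team (coordinator ruling e34b3e0c item (2)),
row-NE7b OWNER lineage `t4-ne7b-p1` (gen 103). Released under the licence of the surrounding project.
-/
import Literature.MathematicalPhysics.QuantumFieldTheory.Balaban1983to89.T4StabilitySocket
import Summits.QuantumFields.BalabanUV.T4Continuum.Support.NE7ApexFrozenPeierls

/-!
# THE DRESSING SUP LETTER IS AT LEAST THE (2.50) FLOOR OVER THE BARE PARTITION FUNCTION — the kernel two-thirds of the
# owner's located finding F-ne7bp1-g103-2 (row NE7b, memo `t4/b2b-balaban-t4-ne7b-p1/g103/F-RHO-TOWER-g103.md` §1)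

Cell `pub-balaban`, sub-cell `t4`, spine estimate NE7b (`T4WeightBudget.RelWeightBound`, the cell's OWN estimate — NOT
PRINTED, NOT PROVED).  Crux-route work under `Spine/NE7b/`; no `T4Continuum/Support` leaf typed, no `Prop` of Bałaban's
minted, no `[cite:]` tag; zero `sorry`.  Imports the Literature module `T4StabilitySocket` ((2.50)-lower integrated,
`smallFieldMass`) and the Support leaf `NE7ApexFrozenPeierls` (`boltzmann_one`).

WHY.  The (α) road's END records (`…TowerStepRangeDataLWR`, 1R ∕ 2R ∕ 3R, `HistReadDataLWL∕LWR`) display a sup letter of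
the dressed initial density, `hBρ : |ρ₀ K t y| ≤ B K t`, with the K-UNIFORM envelope `hBA : log (B K t) ≤ BA∞` feeding
`Nup := e^{BA∞}·m∞·W∞`, AND the (2.50)-floor letters `floor : c₀ ≤ smallFieldMass D K (g₀ K)`, `sites : numSites K ≤ n₁`.
At the intended dressing `ρ₀ K t y = e^{t·obs K y} · D.dens K (g₀ K) 0 y` (IR-102-1) these letters pull against each other
through the bare partition function: THIS FILE PROVES (kernel) that any such `B` satisfies
`B · Z_K ≥ e^{−|t|·B_obs} · e^{−e₋(g_K)·|T₁^{(K)}|} · smallFieldMass D K g₀`, `Z_K = Missing.partitionFn (F.P K) (g₀⁻²)`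
(§2), i.e. `log B ≥ −|t|B_obs − e₋(g_K)|T₁^{(K)}| + log smallFieldMass − log Z_K` (§3).  The remaining third of the
finding — `−log Z_K ≳ c·L^{4K}` (independent Haar holonomies on link-disjoint plaquettes of the level-0 lattice of the
K-th torus; asymptotic freedom keeps `β_K = g₀(K)⁻² ≥ β_min > 0`) — is LOCATED, not typed here; with it, no real `BA∞`
satisfies `hBA` at the intended dressing for any `K ≥ K₀`, and the END's by-name road is vacuous at the intended
instance (owner ruling W-ne7bp1-g103-1∕-2: the road is re-cut at the per-class RELATIVE display
`…NE7b.PinnedExtraction.ExtractionLaws`, whose envelopes are the full sum itself).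

WHAT IS PROVED ([folklore]; Bochner bookkeeping over the tree's own dictionary `T4Continuum.FiniteEpsData`):
* §1 `dens_zero_one_mul_partitionFn` — `D.dens K g₀ 0 1 · Z_K = ∫ ρ_K dV_K`: the initial density AT THE UNIT
  CONFIGURATION is Bałaban's normalisation constant `c = e^{−E}` (`Realisation.rho_zero`, `boltzmann_one`), and
  `c · Z_K = ∫ρ_K` (`FiniteEpsData.integral_dens_eq_zero`, [Balaban1985UV3] (6) as carried by the tree).
* §2 `floor_le_dens_zero_one_mul_partitionFn` — with (B)'s `Cor3With` and the interval hypothesis, (2.50)-lower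
  integrated (`T4StabilitySocket.exp_neg_mul_smallFieldMass_le_integral_dens`) gives
  `e^{−e₋(g_K)·numSites K} · smallFieldMass ≤ D.dens K g₀ 0 1 · Z_K`;
  **`floor_le_supLetter_mul_partitionFn`** — for ANY observable `|obs| ≤ B_obs`, source `t` and ANY sup letter `B` of the
  dressed density `y ↦ e^{t·obs y}·D.dens K g₀ 0 y`: `e^{−|t|B_obs} · e^{−e₋·numSites} · smallFieldMass ≤ B · Z_K`.
* §3 **`log_supLetter_ge`** — the logarithmic form `−|t|B_obs − e₋·numSites + log smallFieldMass − log Z_K ≤ log B`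
  (for `Z_K > 0`, `smallFieldMass > 0`), the shape the END's `hBA` would have to dominate.
* §4 (v1.1, append-only) **`partitionFn_ge_of_letters`** — the END's letters at one cutoff (`hBρ` with `log B ≤ BA∞`,
  `c₀ ≤ smallFieldMass`, `numSites ≤ n₁`, `e₋ ≤ ē`) force the K-FREE floor `exp(−|t|B_obs − ē n₁ − BA∞)·c₀ ≤ Z_K` under
  the BARE Wilson partition function of the `K`-th torus — so a K-uniform `BA∞` would bound `Z_K` below uniformly in `K`,
  against `Z_K → 0`.

NOT HERE (honest).  The divergence `−log Z_K → ∞` (a Haar-independence lemma on the product measure `fieldMeasure`);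
any statement about Bałaban's operations; any change to the END records (they stand as kernel objects).  BY-NAME EFFECT
ON THE WALL: NONE — a located finding made two-thirds kernel.  NE7b NOT PRINTED ∕ NOT PROVED; spine PROVED 0∕9; rung
(B)+1 on a FINITE torus — NOT infinite volume, NOT the mass gap, NOT Clay.
HONEST DEPENDENCY: continuum YM on T⁴ ⇐ BetaPertH ∧ nine spine estimates (0/9 proved); BetaPertH ⇐ (D1) ∧ (D4) ∧
CAP+tail; G-an2-4 gates asym, D1 and NE2/3/4.  This file changes none of it.
-/

set_option autoImplicit false

open MeasureTheory
open Literature.MathematicalPhysics.QuantumFieldTheory.Balaban1983to89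
open Literature.MathematicalPhysics.QuantumFieldTheory.Balaban1983to89.Missing
open Literature.MathematicalPhysics.QuantumFieldTheory.Balaban1983to89.T4Continuum
open Literature.MathematicalPhysics.QuantumFieldTheory.Balaban1983to89.T4StabilitySocket
open Summit.QuantumFields.BalabanUV.T4Continuum.NE7ApexFrozenPeierls (boltzmann_one)

namespace Summit.QuantumFields.BalabanUV.T4Continuum.NE7b.DressingSupFloor

noncomputable section

variable {F : T4Family} {G : Type*} [GaugeGroup G] [MeasurableSpace G] [HaarData G]

/-! ## §1 The initial density at the unit configuration is the normalisation constant: `ρ₀(1) · Z_K = ∫ρ_K` -/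

/-- **`ρ₀(1) · Z_K = ∫ ρ_K dV_K`.**  `ρ₀ = c · e^{−βA}` (`Realisation.rho_zero`) with `e^{−βA(1)} = 1` (`boltzmann_one`), so
`ρ₀(1) = c`; and `∫ρ_K = ∫ρ₀ = c · Z_K` ((0.4) + the push-forward identity, `FiniteEpsData.integral_dens_eq_zero`).
[folklore] -/
theorem dens_zero_one_mul_partitionFn (D : FiniteEpsData F G) (K : ℕ) (g₀ : ℝ) :
    D.dens K g₀ 0 1 * partitionFn (G := G) (F.P K) (g₀⁻¹ ^ 2) =
      ∫ V, D.dens K g₀ K V ∂fieldMeasure (F.P K) K G := by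
  obtain ⟨c, _, h0⟩ := D.real.rho_zero K g₀
  have h1 : D.dens K g₀ 0 1 = c := by
    have h := h0 1
    rw [boltzmann_one, mul_one] at h
    exact h
  have h0' : D.dens K g₀ 0 = fun U => c * boltzmann (F.P K) (g₀⁻¹ ^ 2) U := funext h0
  rw [h1, D.integral_dens_eq_zero K g₀ K le_rfl, h0']
  exact (integral_const_mul c _).symm

/-- The initial density at the unit configuration is positive (it IS the constant `c > 0`). [folklore] -/
theorem dens_zero_one_pos (D : FiniteEpsData F G) (K : ℕ) (g₀ : ℝ) : 0 < D.dens K g₀ 0 1 := by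
  obtain ⟨c, hc, h0⟩ := D.real.rho_zero K g₀
  have h := h0 1
  rw [boltzmann_one, mul_one] at h
  have h' : D.dens K g₀ 0 1 = c := h
  rw [h']
  exact hc

/-! ## §2 (2.50)-lower makes the unit value — hence every sup letter of the dressed density — large against `Z_K` -/

variable [RegularGaugeGroup G]

/-- **THE (2.50) FLOOR UNDER `ρ₀(1) · Z_K`**: `e^{−e₋(g_K)·|T₁^{(K)}|} · smallFieldMass D K g₀ ≤ D.dens K g₀ 0 1 · Z_K`
(`T4StabilitySocket.exp_neg_mul_smallFieldMass_le_integral_dens` + §1). [folklore] -/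
theorem floor_le_dens_zero_one_mul_partitionFn (D : FiniteEpsData F G) (hsign : B16.SignConventions D.C)
    {γB : ℝ} {em ep : ℝ → ℝ} (hcor : B16.Cor3With D.C γB em ep) (K : ℕ) (g₀ : ℝ)
    (hI : (D.C ⟨K, F.m, g₀⟩).flow.InInterval γB K) :
    Real.exp (-(em ((D.C ⟨K, F.m, g₀⟩).flow.g K) * ((D.C ⟨K, F.m, g₀⟩).numSites K : ℝ))) * smallFieldMass D K g₀ ≤
      D.dens K g₀ 0 1 * partitionFn (G := G) (F.P K) (g₀⁻¹ ^ 2) := by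
  rw [dens_zero_one_mul_partitionFn]
  exact exp_neg_mul_smallFieldMass_le_integral_dens D hsign hcor K g₀ hI

omit [RegularGaugeGroup G] in
/-- Any sup letter of the dressed density dominates `e^{−|t|·B_obs} · ρ₀(1)` (evaluate at the unit configuration;
`e^{t·obs 1} ≥ e^{−|t|B_obs}`, `ρ₀(1) ≥ 0`). [folklore] -/
theorem exp_neg_mul_dens_zero_one_le_supLetter (D : FiniteEpsData F G) (K : ℕ) (g₀ : ℝ)
    {obs : GaugeField (F.P K) 0 G → ℝ} {Bobs : ℝ} (hobs : ∀ y, |obs y| ≤ Bobs) (t : ℝ) {B : ℝ}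
    (hB : ∀ y, |Real.exp (t * obs y) * D.dens K g₀ 0 y| ≤ B) :
    Real.exp (-(|t| * Bobs)) * D.dens K g₀ 0 1 ≤ B := by
  have h0 : 0 ≤ D.dens K g₀ 0 1 := (dens_zero_one_pos D K g₀).le
  calc Real.exp (-(|t| * Bobs)) * D.dens K g₀ 0 1
      ≤ Real.exp (t * obs 1) * D.dens K g₀ 0 1 :=
        mul_le_mul_of_nonneg_right (T4GenFunBounds.exp_neg_le_exp_mul_of_abs_le (hobs 1)) h0
    _ = |Real.exp (t * obs 1) * D.dens K g₀ 0 1| :=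
        (abs_of_nonneg (mul_nonneg (Real.exp_pos _).le h0)).symm
    _ ≤ B := hB 1

omit [RegularGaugeGroup G] in
/-- `Z_K ≥ 0` (an integral of the positive Boltzmann weight; `0` only as Bochner's junk value). [folklore] -/
theorem partitionFn_nonneg (K : ℕ) (β : ℝ) : 0 ≤ partitionFn (G := G) (F.P K) β :=
  integral_nonneg fun U => (boltzmann_pos (F.P K) β U).le

/-- **THE FLOOR UNDER `B · Z_K` FOR EVERY SUP LETTER `B` OF THE DRESSED INITIAL DENSITY** (F-ne7bp1-g103-2, kernel part):
for any observable `|obs| ≤ B_obs`, any source `t`, and any `B` with `|e^{t·obs y} · D.dens K g₀ 0 y| ≤ B` for all `y`,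
`e^{−|t|B_obs} · (e^{−e₋(g_K)·numSites K} · smallFieldMass D K g₀) ≤ B · Z_K`.  With the END's letters (`hBρ`, `floor`,
`sites`) the left side is `≥ e^{−l₀} e^{−ē n₁} c₀ > 0`, K-uniformly; so `B K t ≥ (const) ∕ Z_K`. [folklore] -/
theorem floor_le_supLetter_mul_partitionFn (D : FiniteEpsData F G) (hsign : B16.SignConventions D.C)
    {γB : ℝ} {em ep : ℝ → ℝ} (hcor : B16.Cor3With D.C γB em ep) (K : ℕ) (g₀ : ℝ)
    (hI : (D.C ⟨K, F.m, g₀⟩).flow.InInterval γB K)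
    {obs : GaugeField (F.P K) 0 G → ℝ} {Bobs : ℝ} (hobs : ∀ y, |obs y| ≤ Bobs) (t : ℝ) {B : ℝ}
    (hB : ∀ y, |Real.exp (t * obs y) * D.dens K g₀ 0 y| ≤ B) :
    Real.exp (-(|t| * Bobs)) *
        (Real.exp (-(em ((D.C ⟨K, F.m, g₀⟩).flow.g K) * ((D.C ⟨K, F.m, g₀⟩).numSites K : ℝ))) *
          smallFieldMass D K g₀) ≤
      B * partitionFn (G := G) (F.P K) (g₀⁻¹ ^ 2) := by
  have hZ : 0 ≤ partitionFn (G := G) (F.P K) (g₀⁻¹ ^ 2) := partitionFn_nonneg K _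
  calc Real.exp (-(|t| * Bobs)) *
        (Real.exp (-(em ((D.C ⟨K, F.m, g₀⟩).flow.g K) * ((D.C ⟨K, F.m, g₀⟩).numSites K : ℝ))) *
          smallFieldMass D K g₀)
      ≤ Real.exp (-(|t| * Bobs)) * (D.dens K g₀ 0 1 * partitionFn (G := G) (F.P K) (g₀⁻¹ ^ 2)) :=
        mul_le_mul_of_nonneg_left (floor_le_dens_zero_one_mul_partitionFn D hsign hcor K g₀ hI) (Real.exp_pos _).le
    _ = (Real.exp (-(|t| * Bobs)) * D.dens K g₀ 0 1) * partitionFn (G := G) (F.P K) (g₀⁻¹ ^ 2) := by ring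
    _ ≤ B * partitionFn (G := G) (F.P K) (g₀⁻¹ ^ 2) :=
        mul_le_mul_of_nonneg_right (exp_neg_mul_dens_zero_one_le_supLetter D K g₀ hobs t hB) hZ

/-! ## §3 The logarithmic form the END's `hBA` would have to dominate -/

/-- **`log B ≥ −|t|·B_obs − e₋(g_K)·numSites K + log smallFieldMass − log Z_K`** for every sup letter `B` of the dressed
initial density, whenever `Z_K > 0` and `smallFieldMass > 0` (the END's `floor` with `c₀ > 0` gives the latter).  Since
`−log Z_K` grows like the number of plaquettes of the level-0 lattice (located: independent Haar holonomies on
link-disjoint plaquettes), no K-uniform `BA∞` bounds `log B K t` at the intended dressing. [folklore] -/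
theorem log_supLetter_ge (D : FiniteEpsData F G) (hsign : B16.SignConventions D.C)
    {γB : ℝ} {em ep : ℝ → ℝ} (hcor : B16.Cor3With D.C γB em ep) (K : ℕ) (g₀ : ℝ)
    (hI : (D.C ⟨K, F.m, g₀⟩).flow.InInterval γB K)
    {obs : GaugeField (F.P K) 0 G → ℝ} {Bobs : ℝ} (hobs : ∀ y, |obs y| ≤ Bobs) (t : ℝ) {B : ℝ}
    (hB : ∀ y, |Real.exp (t * obs y) * D.dens K g₀ 0 y| ≤ B)
    (hZ : 0 < partitionFn (G := G) (F.P K) (g₀⁻¹ ^ 2)) (hlow : 0 < smallFieldMass D K g₀) :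
    -(|t| * Bobs) - em ((D.C ⟨K, F.m, g₀⟩).flow.g K) * ((D.C ⟨K, F.m, g₀⟩).numSites K : ℝ) +
        Real.log (smallFieldMass D K g₀) - Real.log (partitionFn (G := G) (F.P K) (g₀⁻¹ ^ 2)) ≤
      Real.log B := by
  have hmain := floor_le_supLetter_mul_partitionFn D hsign hcor K g₀ hI hobs t hB
  set e₁ := Real.exp (-(|t| * Bobs)) with he₁
  set e₂ := Real.exp (-(em ((D.C ⟨K, F.m, g₀⟩).flow.g K) * ((D.C ⟨K, F.m, g₀⟩).numSites K : ℝ))) with he₂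
  set Z := partitionFn (G := G) (F.P K) (g₀⁻¹ ^ 2) with hZdef
  have hlhs : 0 < e₁ * (e₂ * smallFieldMass D K g₀) :=
    mul_pos (Real.exp_pos _) (mul_pos (Real.exp_pos _) hlow)
  have hBZ : 0 < B * Z := lt_of_lt_of_le hlhs hmain
  have hBpos : 0 < B := by
    rcases pos_and_pos_or_neg_and_neg_of_mul_pos hBZ with h | h
    · exact h.1
    · exact absurd h.2 (not_lt.mpr hZ.le)
  have hlog := Real.log_le_log hlhs hmain
  rw [Real.log_mul (Real.exp_pos _).ne' (mul_pos (Real.exp_pos _) hlow).ne',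
    Real.log_mul (Real.exp_pos _).ne' hlow.ne', Real.log_exp, Real.log_exp,
    Real.log_mul hBpos.ne' hZ.ne'] at hlog
  linarith

/-! ## §4 What the END's letters would force: a K-UNIFORM POSITIVE FLOOR under the bare Wilson partition functions -/

/-- **THE END's LETTERS IMPLY A UNIFORM FLOOR UNDER `Z_K`.**  If, at some cutoff `K`, the dressed initial density
`y ↦ e^{t·obs y}·D.dens K g₀ 0 y` (`|obs| ≤ B_obs`) has a sup letter `B` with `log B ≤ BA∞` (the END's `hBρ`, `hBA`), the
(2.50) floor letters hold (`c₀ ≤ smallFieldMass`, `numSites ≤ n₁`, `e₋(g_K) ≤ ē`, `0 ≤ numSites`) and (B)'s `Cor3With` applies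
on the interval, then the BARE Wilson partition function of the `K`-th torus is bounded BELOW by the K-free number
`exp(−|t|B_obs − ē·n₁ − BA∞) · c₀`.  Since `Z_K → 0` as the torus is refined (located: `−log Z_K ≍ L^{4K}`), the END's
K-uniform `BA∞` cannot exist at the intended dressing (F-ne7bp1-g103-2). [folklore] -/
theorem partitionFn_ge_of_letters (D : FiniteEpsData F G) (hsign : B16.SignConventions D.C)
    {γB : ℝ} {em ep : ℝ → ℝ} (hcor : B16.Cor3With D.C γB em ep) (K : ℕ) (g₀ : ℝ)
    (hI : (D.C ⟨K, F.m, g₀⟩).flow.InInterval γB K)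
    {obs : GaugeField (F.P K) 0 G → ℝ} {Bobs : ℝ} (hobs : ∀ y, |obs y| ≤ Bobs) (t : ℝ) {B BAi : ℝ}
    (hB : ∀ y, |Real.exp (t * obs y) * D.dens K g₀ 0 y| ≤ B) (hBA : Real.log B ≤ BAi)
    {c₀ n₁ ebar : ℝ} (hc₀ : 0 < c₀) (hfloor : c₀ ≤ smallFieldMass D K g₀)
    (hsites : ((D.C ⟨K, F.m, g₀⟩).numSites K : ℝ) ≤ n₁) (hsites0 : 0 ≤ ((D.C ⟨K, F.m, g₀⟩).numSites K : ℝ))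
    (hem : em ((D.C ⟨K, F.m, g₀⟩).flow.g K) ≤ ebar) (hem0 : 0 ≤ ebar) :
    Real.exp (-(|t| * Bobs) - ebar * n₁ - BAi) * c₀ ≤ partitionFn (G := G) (F.P K) (g₀⁻¹ ^ 2) := by
  have hmain := floor_le_supLetter_mul_partitionFn D hsign hcor K g₀ hI hobs t hB
  have hZ : 0 ≤ partitionFn (G := G) (F.P K) (g₀⁻¹ ^ 2) := partitionFn_nonneg K _
  -- `B > 0` and `B ≤ e^{BA∞}`
  have hlow : 0 < smallFieldMass D K g₀ := lt_of_lt_of_le hc₀ hfloor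
  have hlhs : 0 < Real.exp (-(|t| * Bobs)) *
      (Real.exp (-(em ((D.C ⟨K, F.m, g₀⟩).flow.g K) * ((D.C ⟨K, F.m, g₀⟩).numSites K : ℝ))) *
        smallFieldMass D K g₀) := mul_pos (Real.exp_pos _) (mul_pos (Real.exp_pos _) hlow)
  have hBZ : 0 < B * partitionFn (G := G) (F.P K) (g₀⁻¹ ^ 2) := lt_of_lt_of_le hlhs hmain
  have hBpos : 0 < B := by
    rcases pos_and_pos_or_neg_and_neg_of_mul_pos hBZ with h | h
    · exact h.1
    · exact absurd h.2 (not_lt.mpr hZ)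
  have hBle : B ≤ Real.exp BAi := by
    have := Real.exp_le_exp.mpr hBA
    rwa [Real.exp_log hBpos] at this
  -- the exponent comparison: `−ē n₁ ≤ −e₋(g_K)·numSites`
  have hexp2 : Real.exp (-(ebar * n₁)) ≤
      Real.exp (-(em ((D.C ⟨K, F.m, g₀⟩).flow.g K) * ((D.C ⟨K, F.m, g₀⟩).numSites K : ℝ))) := by
    apply Real.exp_le_exp.mpr
    have h1 : em ((D.C ⟨K, F.m, g₀⟩).flow.g K) * ((D.C ⟨K, F.m, g₀⟩).numSites K : ℝ) ≤
        ebar * ((D.C ⟨K, F.m, g₀⟩).numSites K : ℝ) := mul_le_mul_of_nonneg_right hem hsites0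
    have h2 : ebar * ((D.C ⟨K, F.m, g₀⟩).numSites K : ℝ) ≤ ebar * n₁ := mul_le_mul_of_nonneg_left hsites hem0
    linarith
  -- assemble: `e^{−|t|B_obs − ē n₁ − BA∞}·c₀ = e^{−BA∞}·(e^{−|t|B_obs}·(e^{−ē n₁}·c₀)) ≤ e^{−BA∞}·(B·Z) ≤ Z`
  have hstep : Real.exp (-(|t| * Bobs)) * (Real.exp (-(ebar * n₁)) * c₀) ≤
      B * partitionFn (G := G) (F.P K) (g₀⁻¹ ^ 2) :=
    le_trans (mul_le_mul_of_nonneg_left (mul_le_mul hexp2 hfloor hc₀.le (Real.exp_pos _).le) (Real.exp_pos _).le)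
      hmain
  have hsplit : Real.exp (-(|t| * Bobs) - ebar * n₁ - BAi) * c₀ =
      Real.exp (-BAi) * (Real.exp (-(|t| * Bobs)) * (Real.exp (-(ebar * n₁)) * c₀)) := by
    rw [show -(|t| * Bobs) - ebar * n₁ - BAi = -BAi + (-(|t| * Bobs) + -(ebar * n₁)) by ring, Real.exp_add,
      Real.exp_add]
    ring
  rw [hsplit]
  calc Real.exp (-BAi) * (Real.exp (-(|t| * Bobs)) * (Real.exp (-(ebar * n₁)) * c₀))
      ≤ Real.exp (-BAi) * (B * partitionFn (G := G) (F.P K) (g₀⁻¹ ^ 2)) :=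
        mul_le_mul_of_nonneg_left hstep (Real.exp_pos _).le
    _ = (Real.exp (-BAi) * B) * partitionFn (G := G) (F.P K) (g₀⁻¹ ^ 2) := by ring
    _ ≤ 1 * partitionFn (G := G) (F.P K) (g₀⁻¹ ^ 2) := by
        refine mul_le_mul_of_nonneg_right ?_ hZ
        calc Real.exp (-BAi) * B ≤ Real.exp (-BAi) * Real.exp BAi :=
              mul_le_mul_of_nonneg_left hBle (Real.exp_pos _).le
          _ = 1 := by rw [← Real.exp_add, neg_add_cancel, Real.exp_zero]
    _ = partitionFn (G := G) (F.P K) (g₀⁻¹ ^ 2) := one_mul _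

end

end Summit.QuantumFields.BalabanUV.T4Continuum.NE7b.DressingSupFloor
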